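import Summits.ABC.IUTFork.Repair.RHSigmaMassGap
import HarnessLib

/-!
# R-H ROUND 2, EXPONENT PROGRAMME (EXP-SPEC §0 «μ EXPLICIT IN THE DATUM»): the MASS FRACTION `μ = mass(σ)/M` of a stratum — explicit place
# weights `h_p`, the label-segment closed form `mass(σ) = (1/l⋇)·Σ_p S(j₀(p))·h_p`, `M = (S(l⋇)/l⋇)·Σ_p h_p`, two-sided slice-depth bounds

abc-iut cell, rung LADDER-ABC:A2.RESCUE.H; R-H ROUND 2 seat abc-iut-rh2-w-1 (GEN 2; Q1′ WEIGHTS typer, kernel side). rh-lead g2's EXPONENT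
PROGRAMME (`plan/rescue/R-H/ROUND2/EXP-SPEC.md` v0, 2026-08-27T00:58Z) asks for «μ EXPLICIT IN THE DATUM»: the one theorem F5
`Conditional.SigmaMass.abcExp_of_licenceOn_mu_content_hregC (μ₀)` takes the binder [MU-C] «`B_triv(σᶜ)(T) ≤ (1−μ₀)·M(T) + Tol(P,l)`» = abc-iut-rh2-xi-1's
`OffSigmaTolerance (1−μ₀) (SigmaMass.tol P l) T (offTrivialMass … σ)` VERBATIM, and the instance of interest is `μ₀ ≤ μ(T) := mass(Σ_data)(T)/T.gap`.
This PROOF-ONLY file (0 definitions, 0 `Prop` facts; companion `Repair/RHSigmaMassMuDatum.lean` threads it to `T` and to `OffSigmaTolerance` by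
name) supplies the GENERIC and BED-LEVEL arithmetic of `μ`, over this seat's `Repair/RHCellWeights.lean` (p476759/p477616), `RHCellWeightsBed.lean`
(p477159), `RHSigmaMassGap.lean` (p478601) and abc-iut-rh2-T-1's `Repair/RHSigmaMass.lean` (p477034/p478609), all cited BY NAME, nothing restated:
* §0 LABEL ARITHMETIC, cubic MINORANT: `((m−1)/(n+1))³ ≤ S(m)/S(n)` (`sqSubOneSum_frac_ge_cubic`; with p476759's majorant
  `S(m)/S(n) ≤ (m/n)²·(2m+5)/(2n+5)`: the «(j₀/l⋇)³ law» of MIN-SLICE §(iv) is SANDWICHED, `S(k) = k(k−1)(2k+5)/6 = Σ_{j≤k}(j²−1)`);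
* §1 GENERIC (this seat's spelled-out weight `t(i,v_ℚ) = ((i+1)²−1)·(−qLocal_{i+1,v_ℚ})`): the LOWER uniform slice bound — a window containing the
  first `J` labels at every packet of non-zero q-volume has `S(J)·M ≤ S(l⋇)·mass(W)` (`sqSubOneSum_mul_totalMass_le_of_segment_subset`), the mirror of
  p477616's upper bound `S(l⋇)·mass(W) ≤ S(J)·M` for slices of `≤ J` labels (the generic [MU-C] algebra in rh2-T-1's vocabulary —
  `mass(σ)` monotone, single-cell positivity, `0 ≤ μ ≤ 1`, `B_triv(σᶜ) ≤ κ·M + A ⟺ (1−κ)·M − A ≤ mass(σ)` — is §1 of the companion file);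
* §2 AT THE GENUINE BED `settingPrVolSharp X` (ANY Dupuy–Hilado pilot datum `X`, REALISING ideles): the PLACE WEIGHT of the packet `v_ℚ` is EXPLICIT,
  `h(v_ℚ) := −qLocal_{j,v_ℚ} = (1/[F:ℚ])·Σ_{v | p} P_q(v)·log N(v)` at `v_ℚ = p` and `0` at `∞` (`negQLocal_settingPrVolSharp_eq_placeWeight`; abc-iut-c312-7
  `qLocal_settingPrVol_qCentreDH_inr`, abc-iut-rp-h1 `CandExplicit30Real.qLocal_settingPrVolSharp_inl` — the `h_p` of `CandExplicit30Real.abs_qLocal_settingPrVolSharp_inr`);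
  **`M = deĝ_lgp(P_Θ) − deĝ(P_q) = (S(l⋇)/l⋇)·Σᶠ_{v_ℚ} h(v_ℚ)`** (`totalTrivialMass_settingPrVolSharp_eq_sqSubOneSum_mul_finsum_placeWeight`); for a stratum `σ` whose cells at every
  packet are the initial segment `j ≤ j₀(v_ℚ)` (`plan/rescue/R-H/SLICE.md`: every kept row; R15) **`mass(σ) = (1/l⋇)·Σᶠ_{v_ℚ} S(j₀(v_ℚ))·h(v_ℚ)`**
  (`onTrivialMass_settingPrVolSharp_labelSegment_eq`) — so **`μ = Σ_p S(j₀(p))·h_p / (S(l⋇)·Σ_p h_p)`**, EXP-SPEC §0's formula, as a quotient of two NAMED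
  kernel numbers; and the two slice-depth bounds `S(J)·gap ≤ S(l⋇)·mass(σ)` (first `J` labels licensed at every packet with `h ≠ 0`:
  `sqSubOneSum_mul_pilotGap_le_onTrivialMass_of_segment_subset`) and `S(l⋇)·mass(σ) ≤ S(J)·gap` (at most `J` labels per packet:
  `sqSubOneSum_mul_onTrivialMass_le_pilotGap_of_uniform`) — i.e. **`S(J_min)/S(l⋇) ≤ μ ≤ S(J_max)/S(l⋇)`**.
HONEST FRAMING: identities/inequalities about OUR typed quantities; nothing here asserts that abc is proved or refuted, or that [IUTchIII] Cor. 3.12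
holds or fails at any datum, or takes a side on any author; [MU-C]/[LIC-C] stay HYPOTHESES of F5; whether genuine data supply `μ(T) ≥ μ₀ > 0` on the
content locus is OPEN (EXP-SPEC §4); typed ≠ proved; computed ≠ proved. [claim: Mochizuki2012, status: disputed] for every IUT locution.
[cite: Mochizuki2012, IUTchIII Cor. 3.12 p. 173–174, Prop. 3.9 (i)–(iii) p. 116–117; IUTchIV Def. 1.9 (i) p. 22, Thm. 1.10 p. 23, Step (v) p. 27–29,
Step (viii) p. 30] [cite: DupuyHilado2025, §3.3, §3.9, Thm. 3.10.1]
-/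

noncomputable section

open Set Function NumberField IsDedekindDomain
open scoped Pointwise

namespace Summit.ABC.IUTFork.Repair.RH.CellWeights

open Summit.ABC.IUTFork.Thm311 Summit.ABC.IUTFork.Thm311.Real Summit.ABC.IUTFork.Cor312 Summit.ABC.IUTFork.Cor312.Setting
  Summit.ABC.IUTFork.Cor312Vol Summit.ABC.IUTFork.Cor312Prov Literature.IUT.LogThetaLattice Literature.IUT.LogVolume
  Literature.IUT.HodgeTheaters Literature.IUT.LogVolume.ThetaData
  Summit.ABC.IUTFork.Repair.RH.SigmaLicence Summit.ABC.IUTFork.Repair.RH.SigmaStrataEq Summit.ABC.IUTFork.Repair.RH.SigmaMass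

/-! ## §0. Label arithmetic: the cubic MINORANT of the slice fraction `S(m)/S(n)` -/

section LabelArithmetic

/-- **Slice fraction, cubic MINORANT**: `S(n)·(m−1)³ ≤ S(m)·(n+1)³` for all `m, n ∈ ℕ`, `S(k) = k(k−1)(2k+5)/6 = Σ_{j ≤ k} (j² − 1)`, i.e.
`((m−1)/(n+1))³ ≤ S(m)/S(n)`: an initial segment of `m` labels out of `n` carries AT LEAST this fraction of a place's `j²−1`-weighted demand (with
p476759 `sqSubOneSum_frac_le_cubic`: `≤ (m/n)²·(2m+5)/(2n+5)` — the «(j₀/l⋇)³» law of MIN-SLICE §(iv), sandwiched). From `6·S(m) ≥ 2(m−1)³`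
(`= (9m−2)(m−1) ≥ 0`) and `6·S(n) ≤ 2(n+1)³`. [folklore] -/
theorem sqSubOneSum_frac_ge_cubic (m n : ℕ) :
    (n : ℝ) * (n - 1) * (2 * n + 5) / 6 * ((m : ℝ) - 1) ^ 3 ≤ (m : ℝ) * (m - 1) * (2 * m + 5) / 6 * ((n : ℝ) + 1) ^ 3 := by
  have hn : (0 : ℝ) ≤ n := Nat.cast_nonneg n
  have hSn : 3 * ((n : ℝ) * (n - 1) * (2 * n + 5) / 6) ≤ ((n : ℝ) + 1) ^ 3 := by nlinarith [sq_nonneg (n : ℝ)]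
  have hSn0 : (0 : ℝ) ≤ (n : ℝ) * (n - 1) * (2 * n + 5) / 6 := by
    have h := sqSubOneSum_mono (Nat.zero_le n)
    simpa using h
  rcases Nat.eq_zero_or_pos m with h0 | hpos
  · subst h0
    norm_num
    exact hSn0
  · have h1 : (1 : ℝ) ≤ m := by exact_mod_cast hpos
    have hm1 : (0 : ℝ) ≤ ((m : ℝ) - 1) ^ 3 := pow_nonneg (by linarith) 3
    have hn1 : (0 : ℝ) ≤ ((n : ℝ) + 1) ^ 3 := by positivity
    have hSm : ((m : ℝ) - 1) ^ 3 ≤ 3 * ((m : ℝ) * (m - 1) * (2 * m + 5) / 6) := by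
      nlinarith [mul_nonneg (by linarith : (0 : ℝ) ≤ 9 * m - 2) (by linarith : (0 : ℝ) ≤ m - 1)]
    calc (n : ℝ) * (n - 1) * (2 * n + 5) / 6 * ((m : ℝ) - 1) ^ 3
        ≤ ((n : ℝ) + 1) ^ 3 / 3 * ((m : ℝ) - 1) ^ 3 := mul_le_mul_of_nonneg_right (by linarith) hm1
      _ = ((m : ℝ) - 1) ^ 3 / 3 * ((n : ℝ) + 1) ^ 3 := by ring
      _ ≤ (m : ℝ) * (m - 1) * (2 * m + 5) / 6 * ((n : ℝ) + 1) ^ 3 := mul_le_mul_of_nonneg_right (by linarith) hn1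

/-- `S(n) > 0` for `n ≥ 2` (`S(2) = 3`): the denominator of `μ` never vanishes (`l⋇ ≥ 2`, `ThetaIndex.two_le_lstar`). [folklore] -/
theorem sqSubOneSum_pos {n : ℕ} (hn : 2 ≤ n) : 0 < (n : ℝ) * (n - 1) * (2 * n + 5) / 6 := by
  have h2 : (2 : ℝ) ≤ n := by exact_mod_cast hn
  have h1 : (0 : ℝ) < (n : ℝ) - 1 := by linarith
  positivity

end LabelArithmetic

/-! ## §1. Generic, spelled-out weights: the LOWER uniform slice bound (first `J` labels at every massive packet ⟹ `S(J)·M ≤ S(l⋇)·mass(W)`) -/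

section LabelSegmentLower

variable {T : ThetaIndex} {S : Situation T} (P : Cor312.Setting S)

/-- **LOWER UNIFORM SLICE BOUND (place-sum form).** If the window `W` contains the cells `(i, v_ℚ)` with `i + 1 ≤ J` at every packet `v_ℚ` of NON-ZERO
(label-independent) q-volume `q(v_ℚ) ≤ 0`, finitely supported, then `S(J)·(Σᶠ_{v_ℚ} (−q(v_ℚ)))/l⋇ ≤ mass(W)`, `S(J) = J(J−1)(2J+5)/6` — the comparison
window `{(i,v_ℚ) : q(v_ℚ) ≠ 0, i+1 ≤ J}` is a label segment of mass exactly the left side (p477616 `mass_labelSegment_eq`) and lies inside `W`. [folklore] -/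
theorem sqSubOneSum_mul_finsum_div_le_mass_of_segment_subset {q : T.VQ → ℝ}
    (hq : ∀ (i : Fin T.lstar) (vQ : T.VQ), P.qLocal (labelSucc i) vQ = q vQ) (hq0 : ∀ vQ : T.VQ, q vQ ≤ 0) {J : ℕ} (hJ : J ≤ T.lstar)
    (W : Set (Fin T.lstar × T.VQ)) (hW : ∀ (i : Fin T.lstar) (vQ : T.VQ), q vQ ≠ 0 → (i : ℕ) + 1 ≤ J → (i, vQ) ∈ W) :
    (J : ℝ) * (J - 1) * (2 * J + 5) / 6 * (∑ᶠ vQ : T.VQ, -q vQ) / T.lstar ≤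
      processionNormalized (fun i : Fin T.lstar => ∑ᶠ vQ : T.VQ,
        W.indicator (fun c : Fin T.lstar × T.VQ => ((((c.1 : ℕ) : ℝ) + 1) ^ 2 - 1) * (-P.qLocal (labelSucc c.1) c.2)) (i, vQ)) := by
  classical
  -- the comparison window: the first `J` labels at every massive packet
  let j₀ : T.VQ → ℕ := fun vQ => if q vQ = 0 then 0 else J
  let W₀ : Set (Fin T.lstar × T.VQ) := {c | (c.1 : ℕ) + 1 ≤ j₀ c.2}
  have hsub : W₀ ⊆ W := by
    rintro ⟨i, vQ⟩ hc
    change (i : ℕ) + 1 ≤ j₀ vQ at hc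
    by_cases h : q vQ = 0
    · simp [j₀, h] at hc
    · simp only [j₀, if_neg h] at hc
      exact hW i vQ h hc
  have hj : ∀ vQ, j₀ vQ ≤ T.lstar := fun vQ => by
    dsimp only [j₀]
    split_ifs <;> omega
  have hseg : ∀ (i : Fin T.lstar) (vQ : T.VQ), (i, vQ) ∈ W₀ ↔ (i : ℕ) + 1 ≤ j₀ vQ := fun _ _ => Iff.rfl
  have hmass₀ := mass_labelSegment_eq P hq hj W₀ hseg
  have hterm : ∀ vQ : T.VQ, (j₀ vQ : ℝ) * (j₀ vQ - 1) * (2 * j₀ vQ + 5) / 6 * (-q vQ) = (J : ℝ) * (J - 1) * (2 * J + 5) / 6 * (-q vQ) := by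
    intro vQ
    by_cases h : q vQ = 0
    · rw [h, neg_zero, mul_zero, mul_zero]
    · simp only [j₀, if_neg h]
  have hnn : ∀ c : Fin T.lstar × T.VQ, 0 ≤ ((((c.1 : ℕ) : ℝ) + 1) ^ 2 - 1) * (-P.qLocal (labelSucc c.1) c.2) :=
    fun c => pilotGapWeight_nonneg P (by rw [hq]; exact hq0 c.2)
  have hmono : processionNormalized (fun i : Fin T.lstar => ∑ᶠ vQ : T.VQ,
        W₀.indicator (fun c : Fin T.lstar × T.VQ => ((((c.1 : ℕ) : ℝ) + 1) ^ 2 - 1) * (-P.qLocal (labelSucc c.1) c.2)) (i, vQ)) ≤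
      processionNormalized (fun i : Fin T.lstar => ∑ᶠ vQ : T.VQ,
        W.indicator (fun c : Fin T.lstar × T.VQ => ((((c.1 : ℕ) : ℝ) + 1) ^ 2 - 1) * (-P.qLocal (labelSucc c.1) c.2)) (i, vQ)) := by
    unfold processionNormalized
    refine div_le_div_of_nonneg_right (Finset.sum_le_sum fun i _ => ?_) (Nat.cast_nonneg _)
    exact finsum_le_finsum' (support_indicator_pilotGapWeight_finite P W₀ i) (support_indicator_pilotGapWeight_finite P W i)
      fun vQ => Set.indicator_le_indicator_of_subset hsub hnn _
  refine le_trans (le_of_eq ?_) (hmass₀.symm.le.trans hmono)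
  rw [finsum_congr hterm, ← mul_finsum]

/-- **LOWER UNIFORM SLICE BOUND (mass form): `S(J)·M ≤ S(l⋇)·mass(W)`** in the same situation (`M = (S(l⋇)/l⋇)·Σᶠ(−q)`, p477616
`totalMass_eq_finsum_placeSum`) — i.e. `mass(W)/M ≥ S(J)/S(l⋇) ≥ ((J−1)/(l⋇+1))³` (§0): the mirror of p477616's UPPER bound
`sqSubOneSum_mul_mass_le_of_uniform` (slices of `≤ J` labels ⟹ `S(l⋇)·mass(W) ≤ S(J)·M`). [claim: Mochizuki2012, status: disputed] -/
theorem sqSubOneSum_mul_totalMass_le_of_segment_subset {q : T.VQ → ℝ}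
    (hq : ∀ (i : Fin T.lstar) (vQ : T.VQ), P.qLocal (labelSucc i) vQ = q vQ) (hq0 : ∀ vQ : T.VQ, q vQ ≤ 0) {J : ℕ} (hJ : J ≤ T.lstar)
    (W : Set (Fin T.lstar × T.VQ)) (hW : ∀ (i : Fin T.lstar) (vQ : T.VQ), q vQ ≠ 0 → (i : ℕ) + 1 ≤ J → (i, vQ) ∈ W) :
    (J : ℝ) * (J - 1) * (2 * J + 5) / 6 *
        processionNormalized (fun i : Fin T.lstar => ∑ᶠ vQ : T.VQ, ((((i : ℕ) : ℝ) + 1) ^ 2 - 1) * (-P.qLocal (labelSucc i) vQ)) ≤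
      (T.lstar : ℝ) * (T.lstar - 1) * (2 * T.lstar + 5) / 6 *
        processionNormalized (fun i : Fin T.lstar => ∑ᶠ vQ : T.VQ,
          W.indicator (fun c : Fin T.lstar × T.VQ => ((((c.1 : ℕ) : ℝ) + 1) ^ 2 - 1) * (-P.qLocal (labelSucc c.1) c.2)) (i, vQ)) := by
  have hmass := sqSubOneSum_mul_finsum_div_le_mass_of_segment_subset P hq hq0 hJ W hW
  have hSl : (0 : ℝ) ≤ (T.lstar : ℝ) * (T.lstar - 1) * (2 * T.lstar + 5) / 6 := (sqSubOneSum_pos T.two_le_lstar).le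
  rw [totalMass_eq_finsum_placeSum P hq, ← mul_finsum]
  calc (J : ℝ) * (J - 1) * (2 * J + 5) / 6 *
        ((T.lstar : ℝ) * (T.lstar - 1) * (2 * T.lstar + 5) / 6 * (∑ᶠ vQ : T.VQ, -q vQ) / T.lstar)
      = (T.lstar : ℝ) * (T.lstar - 1) * (2 * T.lstar + 5) / 6 *
          ((J : ℝ) * (J - 1) * (2 * J + 5) / 6 * (∑ᶠ vQ : T.VQ, -q vQ) / T.lstar) := by ring
    _ ≤ _ := mul_le_mul_of_nonneg_left hmass hSl

end LabelSegmentLower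

/-! ## §2. At the genuine bed `settingPrVolSharp X`: the explicit place weight `h(v_ℚ)`, `M` and `mass(σ)` as place sums, slice-depth bounds -/

section Bed

variable {F : Type} [Field F] [NumberField F] (X : PilotData F) {logv : PadicLogs F} (hlog : LogvAnalytic logv)
  (M : Type) [Field M] [NumberField M]
  (archPk : ∀ (j : (thetaIndex X).Label) (vQ : (thetaIndex X).VQ), Set ((logShellsDH X logv).Packet j vQ))
  (archSub : ∀ (j : (thetaIndex X).Label) (v : (thetaIndex X).V),
    Set ((logShellsDH X logv).Packet j ((thetaIndex X).over v)))
  (Ψ : ℤ → ∀ v : (thetaIndex X).V, v ∈ (thetaIndex X).Vbad → Set ((logShellsDH X logv).StarPacket v))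
  (act : ℤ → ∀ v : (thetaIndex X).V, v ∈ (thetaIndex X).Vbad →
    (logShellsDH X logv).StarPacket v → Module.End ℚ ((logShellsDH X logv).StarPacket v))
  (Mmod : ℤ → ∀ j : (thetaIndex X).LabelStar, Set ((logShellsDH X logv).GlobalPacket j.1))
  (region : ℤ → ∀ j : (thetaIndex X).LabelStar, FinDivisor M → ∀ vQ : (thetaIndex X).VQ,
    Set ((logShellsDH X logv).Packet j.1 vQ))
  (n : ℤ) {HT : Type} {LogLink : HT → HT → Type} {IsFull : ∀ {s t : HT}, LogLink s t → Prop}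
  (lat : LGPGaussianLogThetaLattice LogLink IsFull)
  {Frd : Type} {IsoF : Frd → Frd → Type} {Ob : Frd → Type} {realify : Frd → Frd} {Strip : Type}
  {IsoS : Strip → Strip → Type} {Mv : ∀ v : (thetaIndex X).V, v ∈ (thetaIndex X).Vbad → Type}
  [∀ v h, Monoid (Mv v h)]
  (sig : GlobalLGPFrobenioidSignature (thetaIndex X).lstar (thetaIndex X).V (· ∈ (thetaIndex X).Vbad)
    Frd IsoF Ob realify Strip IsoS Mv)
  (split : SplittingMonoids Mv) {ObΔ : Type} {N : ∀ v : (thetaIndex X).V, v ∈ (thetaIndex X).Vbad → Type}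
  [∀ v h, Monoid (N v h)] (qData : QPilotData ObΔ N)
  (tq : ∀ (pp : Nat.Primes) (x : (thetaIndex X).Fibre (.inr pp)), haveI : Fact (pp : ℕ).Prime := ⟨pp.2⟩; kOf X pp.1 x)
  (t : ∀ (pp : Nat.Primes) (_ : Fin X.lstar) (x : (thetaIndex X).Fibre (.inr pp)),
    haveI : Fact (pp : ℕ).Prime := ⟨pp.2⟩; kOf X pp.1 x)
  (htq0 : ∀ pp x, tq pp x ≠ 0)
  (htq1 : ∀ (pp : Nat.Primes) (x : (thetaIndex X).Fibre (.inr pp)),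
    haveI : Fact (pp : ℕ).Prime := ⟨pp.2⟩; placeOf X pp.1 x ∉ X.S → ‖tq pp x‖ = 1)
  (ht0 : ∀ pp i x, t pp i x ≠ 0)
  (ht1 : ∀ (pp : Nat.Primes) (i : Fin X.lstar) (x : (thetaIndex X).Fibre (.inr pp)),
    haveI : Fact (pp : ℕ).Prime := ⟨pp.2⟩; placeOf X pp.1 x ∉ X.S → ‖t pp i x‖ = 1)
  (ht : ∀ (pp : Nat.Primes) (i : Fin X.lstar) (x : (thetaIndex X).Fibre (.inr pp)),
    haveI : Fact (pp : ℕ).Prime := ⟨pp.2⟩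
    Real.log ‖t pp i x‖ = -(X.thetaPilot i (placeOf X pp.1 x)) * logNorm F (placeOf X pp.1 x) / localDegree F (placeOf X pp.1 x))
  (htq : ∀ (pp : Nat.Primes) (x : (thetaIndex X).Fibre (.inr pp)),
    haveI : Fact (pp : ℕ).Prime := ⟨pp.2⟩
    Real.log ‖tq pp x‖ = -(X.qPilot (placeOf X pp.1 x)) * logNorm F (placeOf X pp.1 x) / localDegree F (placeOf X pp.1 x))

include htq in
/-- **THE PLACE WEIGHT, EXPLICIT**: at the bed with REALISING q-ideles, for every label `j = i+1` and packet `v_ℚ`,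
`−qLocal_{i+1,v_ℚ} = h(v_ℚ)`, `h(p) := (1/[F:ℚ])·Σ_{v | p} P_q(v)·log N(v)` (`= (1/(2l·[F:ℚ]))·Σ_{v|p, v∈S} ord_v(q_v)·log N(v)`, p477159
`pilotGapWeight_inr_eq_sum_ordq`) and `h(∞) := 0` — abc-iut-c312-7's `qLocal_settingPrVol_qCentreDH_inr` and abc-iut-rp-h1's
`CandExplicit30Real.qLocal_settingPrVolSharp_inl`, sign flipped; label-FREE. This is the `h_v` of EXP-SPEC §0 / MIN-SLICE §(iv) at the level of `v_ℚ`.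
[cite: DupuyHilado2025, §3.9, Thm. 3.10.1] [cite: Mochizuki2012, IUTchIV Def. 1.9 (i) p. 22] [claim: Mochizuki2012, status: disputed] -/
theorem negQLocal_settingPrVolSharp_eq_placeWeight (i : Fin (thetaIndex X).lstar) (vQ : (thetaIndex X).VQ) :
    -(settingPrVolSharp X hlog M archPk archSub Ψ act Mmod region n lat sig split qData tq t htq0 htq1).qLocal (labelSucc i) vQ =
      Sum.elim (fun _ : Unit => (0 : ℝ))
        (fun pp : Nat.Primes => (∑ v ∈ placesOver F pp, X.qPilot v * logNorm F v) / Module.finrank ℚ F) vQ := by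
  cases vQ with
  | inl u =>
    rw [CandExplicit30Real.qLocal_settingPrVolSharp_inl X hlog M archPk archSub Ψ act Mmod region n lat sig split qData (t := t) (tq := tq)
      htq0 htq1 (labelSucc i) u, neg_zero, Sum.elim_inl]
  | inr pp =>
    have h : (settingPrVolSharp X hlog M archPk archSub Ψ act Mmod region n lat sig split qData tq t htq0 htq1).qLocal
        (labelSucc i) (.inr pp) = (∑ v ∈ placesOver F pp, -(X.qPilot v) * logNorm F v) / Module.finrank ℚ F :=
      qLocal_settingPrVol_qCentreDH_inr X hlog M archPk archSub Ψ act Mmod region n lat sig split qData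
        (fun _ _ => thetaBoxDH X hlog (sharpBoxDH X hlog t)) tq htq0
        (finite_support_logvol_qRegion_Pr X hlog M archPk archSub Ψ act Mmod region n tq htq0 htq1) htq (labelSucc i) pp
    rw [h, Sum.elim_inr]
    simp only [neg_mul, Finset.sum_neg_distrib, neg_div, neg_neg]

/-- The place weight is `≥ 0` (`P_q ≥ 0`, `ValLine.qPilot_nonneg`; `log N(v) > 0`). [folklore] -/
theorem placeWeight_nonneg (vQ : (thetaIndex X).VQ) :
    0 ≤ Sum.elim (fun _ : Unit => (0 : ℝ))
        (fun pp : Nat.Primes => (∑ v ∈ placesOver F pp, X.qPilot v * logNorm F v) / Module.finrank ℚ F) vQ := by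
  cases vQ with
  | inl u => rw [Sum.elim_inl]
  | inr pp =>
    rw [Sum.elim_inr]
    exact div_nonneg (Finset.sum_nonneg fun v _ => mul_nonneg (ValLine.qPilot_nonneg X v) (logNorm_pos F v).le) (Nat.cast_nonneg _)

include ht0 ht htq in
/-- **`M = (S(l⋇)/l⋇)·Σᶠ_{v_ℚ} h(v_ℚ)`**: rh2-T-1's total trivial mass of the bed (= the Dupuy–Hilado pilot gap `deĝ_lgp(P_Θ) − deĝ(P_q)` of `X`, p478601
`totalTrivialMass_settingPrVolSharp_eq_pilotGap`; = `T.gap` at a genuine datum, p478601 `totalTrivialMass_chosen_eq_gap`) as `S(l⋇)/l⋇` times the total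
place weight (p477616 `totalMass_eq_finsum_placeSum` at the explicit `h`). The DENOMINATOR of `μ`. [cite: DupuyHilado2025, §3.3, Thm. 3.10.1]
[cite: Mochizuki2012, IUTchIV Thm. 1.10 p. 23, Step (v) p. 29] [claim: Mochizuki2012, status: disputed] -/
theorem totalTrivialMass_settingPrVolSharp_eq_sqSubOneSum_mul_finsum_placeWeight :
    totalTrivialMass (settingPrVolSharp X hlog M archPk archSub Ψ act Mmod region n lat sig split qData tq t htq0 htq1) =
      (X.lstar : ℝ) * (X.lstar - 1) * (2 * X.lstar + 5) / 6 *
        (∑ᶠ vQ : (thetaIndex X).VQ, Sum.elim (fun _ : Unit => (0 : ℝ))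
          (fun pp : Nat.Primes => (∑ v ∈ placesOver F pp, X.qPilot v * logNorm F v) / Module.finrank ℚ F) vQ) / X.lstar := by
  have hq : ∀ (i : Fin (thetaIndex X).lstar) (vQ : (thetaIndex X).VQ),
      (settingPrVolSharp X hlog M archPk archSub Ψ act Mmod region n lat sig split qData tq t htq0 htq1).qLocal (labelSucc i) vQ =
        -Sum.elim (fun _ : Unit => (0 : ℝ))
          (fun pp : Nat.Primes => (∑ v ∈ placesOver F pp, X.qPilot v * logNorm F v) / Module.finrank ℚ F) vQ := fun i vQ => by
    rw [← negQLocal_settingPrVolSharp_eq_placeWeight X hlog M archPk archSub Ψ act Mmod region n lat sig split qData tq t htq0 htq1 htq i vQ,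
      neg_neg]
  rw [totalTrivialMass_settingPrVolSharp_eq_pilotGap X hlog M archPk archSub Ψ act Mmod region n lat sig split qData tq t htq0 htq1 ht0 ht htq,
    ← totalMass_settingPrVolSharp_eq_pilotGap X hlog M archPk archSub Ψ act Mmod region n lat sig split qData tq t htq0 htq1 htq,
    totalMass_eq_finsum_placeSum _ hq, ← mul_finsum]
  have hl : ((thetaIndex X).lstar : ℕ) = X.lstar := rfl
  simp only [neg_neg, hl]

include ht0 ht htq in
/-- **`mass(σ) = (1/l⋇)·Σᶠ_{v_ℚ} S(j₀(v_ℚ))·h(v_ℚ)` FOR A LABEL-SEGMENT STRATUM**: if `σ` meets every packet `v_ℚ` exactly in the labels `j = i+1 ≤ j₀(v_ℚ)`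
(`j₀ ≤ l⋇`; the shape of every kept row's `Σ_data`, `plan/rescue/R-H/SLICE.md`, rows 8/15 EXACTLY by abc-iut-rh-typ-12 p476939, row 3 by abc-iut-rh-typ-3
p479453, row 4 by abc-iut-rh2-w-2's `RHHullCellSlice`), then rh2-T-1's `onTrivialMass P σ` IS `(Σᶠ_{v_ℚ} S(j₀(v_ℚ))·h(v_ℚ))/l⋇` with the explicit
place weight `h` (p478601 `onTrivialMass_settingPrVolSharp_eq_mass` ∘ p477616 `mass_labelSegment_eq`). The NUMERATOR of `μ`: with
`totalTrivialMass_settingPrVolSharp_eq_sqSubOneSum_mul_finsum_placeWeight`, **`μ = mass(σ)/M = Σ_{v_ℚ} S(j₀(v_ℚ))·h(v_ℚ) / (S(l⋇)·Σ_{v_ℚ} h(v_ℚ))`** —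
EXP-SPEC §0's formula.
[cite: Mochizuki2012, IUTchIII Prop. 3.9 (i)–(iii) p. 116–117; IUTchIV Thm. 1.10 Step (v) p. 27–29] [cite: DupuyHilado2025, §3.3, Thm. 3.10.1]
[claim: Mochizuki2012, status: disputed] -/
theorem onTrivialMass_settingPrVolSharp_labelSegment_eq {j₀ : (thetaIndex X).VQ → ℕ} (hj : ∀ vQ, j₀ vQ ≤ X.lstar)
    (σ : Set (Fin (thetaIndex X).lstar × (thetaIndex X).VQ))
    (hσ : ∀ (i : Fin (thetaIndex X).lstar) (vQ : (thetaIndex X).VQ), (i, vQ) ∈ σ ↔ (i : ℕ) + 1 ≤ j₀ vQ) :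
    onTrivialMass (settingPrVolSharp X hlog M archPk archSub Ψ act Mmod region n lat sig split qData tq t htq0 htq1) σ =
      (∑ᶠ vQ : (thetaIndex X).VQ, (j₀ vQ : ℝ) * (j₀ vQ - 1) * (2 * j₀ vQ + 5) / 6 *
        Sum.elim (fun _ : Unit => (0 : ℝ))
          (fun pp : Nat.Primes => (∑ v ∈ placesOver F pp, X.qPilot v * logNorm F v) / Module.finrank ℚ F) vQ) / X.lstar := by
  have hq : ∀ (i : Fin (thetaIndex X).lstar) (vQ : (thetaIndex X).VQ),
      (settingPrVolSharp X hlog M archPk archSub Ψ act Mmod region n lat sig split qData tq t htq0 htq1).qLocal (labelSucc i) vQ =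
        -Sum.elim (fun _ : Unit => (0 : ℝ))
          (fun pp : Nat.Primes => (∑ v ∈ placesOver F pp, X.qPilot v * logNorm F v) / Module.finrank ℚ F) vQ := fun i vQ => by
    rw [← negQLocal_settingPrVolSharp_eq_placeWeight X hlog M archPk archSub Ψ act Mmod region n lat sig split qData tq t htq0 htq1 htq i vQ,
      neg_neg]
  rw [onTrivialMass_settingPrVolSharp_eq_mass X hlog M archPk archSub Ψ act Mmod region n lat sig split qData tq t htq0 htq1 ht0 ht htq σ,
    mass_labelSegment_eq _ hq hj σ hσ]
  have hl : ((thetaIndex X).lstar : ℕ) = X.lstar := rfl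
  simp only [neg_neg, hl]

include ht0 ht htq in
/-- **LOWER SLICE-DEPTH BOUND AT THE BED: `S(J)·(deĝ_lgp(P_Θ) − deĝ(P_q)) ≤ S(l⋇)·mass(σ)`** whenever the stratum `σ` contains the first `J ≤ l⋇` labels
`(i, p)`, `i + 1 ≤ J`, at every prime packet `p` of non-zero place weight `h(p)` (the packets over `S`; archimedean and good packets weigh `0` and are
unconstrained) — i.e. **`μ = mass(σ)/M ≥ S(J)/S(l⋇) ≥ ((J−1)/(l⋇+1))³`**: a UNIFORM LICENSED DEPTH `J` is a certificate for EXP-SPEC's [MU-C] with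
`μ₀ := S(J)/S(l⋇)` (companion file `RHSigmaMassMuDatum`). §1 at the explicit `h`. [claim: Mochizuki2012, status: disputed] -/
theorem sqSubOneSum_mul_pilotGap_le_onTrivialMass_of_segment_subset {J : ℕ} (hJ : J ≤ X.lstar)
    (σ : Set (Fin (thetaIndex X).lstar × (thetaIndex X).VQ))
    (hσ : ∀ (i : Fin (thetaIndex X).lstar) (pp : Nat.Primes),
      (∑ v ∈ placesOver F pp, X.qPilot v * logNorm F v) / Module.finrank ℚ F ≠ 0 → (i : ℕ) + 1 ≤ J → (i, Sum.inr pp) ∈ σ) :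
    (J : ℝ) * (J - 1) * (2 * J + 5) / 6 * (LgpDivisor.ndegLgp X.thetaPilot - FinDivisor.ndeg F X.qPilot) ≤
      (X.lstar : ℝ) * (X.lstar - 1) * (2 * X.lstar + 5) / 6 *
        onTrivialMass (settingPrVolSharp X hlog M archPk archSub Ψ act Mmod region n lat sig split qData tq t htq0 htq1) σ := by
  have hq : ∀ (i : Fin (thetaIndex X).lstar) (vQ : (thetaIndex X).VQ),
      (settingPrVolSharp X hlog M archPk archSub Ψ act Mmod region n lat sig split qData tq t htq0 htq1).qLocal (labelSucc i) vQ =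
        -Sum.elim (fun _ : Unit => (0 : ℝ))
          (fun pp : Nat.Primes => (∑ v ∈ placesOver F pp, X.qPilot v * logNorm F v) / Module.finrank ℚ F) vQ := fun i vQ => by
    rw [← negQLocal_settingPrVolSharp_eq_placeWeight X hlog M archPk archSub Ψ act Mmod region n lat sig split qData tq t htq0 htq1 htq i vQ,
      neg_neg]
  have hq0 : ∀ vQ : (thetaIndex X).VQ, -Sum.elim (fun _ : Unit => (0 : ℝ))
      (fun pp : Nat.Primes => (∑ v ∈ placesOver F pp, X.qPilot v * logNorm F v) / Module.finrank ℚ F) vQ ≤ 0 := fun vQ =>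
    neg_nonpos.mpr (placeWeight_nonneg X vQ)
  have hW : ∀ (i : Fin (thetaIndex X).lstar) (vQ : (thetaIndex X).VQ), -Sum.elim (fun _ : Unit => (0 : ℝ))
      (fun pp : Nat.Primes => (∑ v ∈ placesOver F pp, X.qPilot v * logNorm F v) / Module.finrank ℚ F) vQ ≠ 0 →
        (i : ℕ) + 1 ≤ J → (i, vQ) ∈ σ := by
    intro i vQ hne hi
    cases vQ with
    | inl u => exact absurd (by rw [Sum.elim_inl, neg_zero]) hne
    | inr pp =>
      rw [Sum.elim_inr, neg_ne_zero] at hne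
      exact hσ i pp hne hi
  have h := sqSubOneSum_mul_totalMass_le_of_segment_subset _ hq hq0 (J := J) hJ σ hW
  rw [totalMass_settingPrVolSharp_eq_pilotGap X hlog M archPk archSub Ψ act Mmod region n lat sig split qData tq t htq0 htq1 htq,
    ← onTrivialMass_settingPrVolSharp_eq_mass X hlog M archPk archSub Ψ act Mmod region n lat sig split qData tq t htq0 htq1 ht0 ht htq σ] at h
  have hl : ((thetaIndex X).lstar : ℕ) = X.lstar := rfl
  simpa only [hl] using h

include ht0 ht htq in
/-- **UPPER SLICE-DEPTH BOUND AT THE BED: `S(l⋇)·mass(σ) ≤ S(J)·(deĝ_lgp(P_Θ) − deĝ(P_q))`** for a label-segment stratum `σ` with at most `J ≤ l⋇`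
labels at every packet (`j₀(v_ℚ) ≤ J`) — i.e. **`μ ≤ S(J)/S(l⋇) ≤ (J/l⋇)²·(2J+5)/(2l⋇+5)`** (p477616 `sqSubOneSum_mul_mass_le_of_uniform` at the
explicit `h`, p476759 `sqSubOneSum_frac_le_cubic`): MIN-SLICE §(iv)'s «a datum licensing only `j ≤ j₀ < l⋇` at its heavy places has `μ < 1`», bed form.
[claim: Mochizuki2012, status: disputed] -/
theorem sqSubOneSum_mul_onTrivialMass_le_pilotGap_of_uniform {j₀ : (thetaIndex X).VQ → ℕ} {J : ℕ} (hJ : J ≤ X.lstar)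
    (hj : ∀ vQ, j₀ vQ ≤ J) (σ : Set (Fin (thetaIndex X).lstar × (thetaIndex X).VQ))
    (hσ : ∀ (i : Fin (thetaIndex X).lstar) (vQ : (thetaIndex X).VQ), (i, vQ) ∈ σ ↔ (i : ℕ) + 1 ≤ j₀ vQ) :
    (X.lstar : ℝ) * (X.lstar - 1) * (2 * X.lstar + 5) / 6 *
        onTrivialMass (settingPrVolSharp X hlog M archPk archSub Ψ act Mmod region n lat sig split qData tq t htq0 htq1) σ ≤
      (J : ℝ) * (J - 1) * (2 * J + 5) / 6 * (LgpDivisor.ndegLgp X.thetaPilot - FinDivisor.ndeg F X.qPilot) := by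
  have hq : ∀ (i : Fin (thetaIndex X).lstar) (vQ : (thetaIndex X).VQ),
      (settingPrVolSharp X hlog M archPk archSub Ψ act Mmod region n lat sig split qData tq t htq0 htq1).qLocal (labelSucc i) vQ =
        -Sum.elim (fun _ : Unit => (0 : ℝ))
          (fun pp : Nat.Primes => (∑ v ∈ placesOver F pp, X.qPilot v * logNorm F v) / Module.finrank ℚ F) vQ := fun i vQ => by
    rw [← negQLocal_settingPrVolSharp_eq_placeWeight X hlog M archPk archSub Ψ act Mmod region n lat sig split qData tq t htq0 htq1 htq i vQ,
      neg_neg]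
  have hq0 : ∀ vQ : (thetaIndex X).VQ, -Sum.elim (fun _ : Unit => (0 : ℝ))
      (fun pp : Nat.Primes => (∑ v ∈ placesOver F pp, X.qPilot v * logNorm F v) / Module.finrank ℚ F) vQ ≤ 0 := fun vQ =>
    neg_nonpos.mpr (placeWeight_nonneg X vQ)
  have hl0 : 0 < (thetaIndex X).lstar := lt_of_lt_of_le (by norm_num) (thetaIndex X).two_le_lstar
  have hfin : (Function.support fun vQ : (thetaIndex X).VQ => -Sum.elim (fun _ : Unit => (0 : ℝ))
      (fun pp : Nat.Primes => (∑ v ∈ placesOver F pp, X.qPilot v * logNorm F v) / Module.finrank ℚ F) vQ).Finite := by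
    have h1 := support_pilotGapWeight_finite
      (settingPrVolSharp X hlog M archPk archSub Ψ act Mmod region n lat sig split qData tq t htq0 htq1) ⟨1, (thetaIndex X).two_le_lstar⟩
    refine (h1.subset fun vQ hv => ?_)
    rw [Function.mem_support] at hv ⊢
    rw [hq, neg_neg]
    intro h0
    apply hv
    have h3 : ((((1 : ℕ) : ℝ) + 1) ^ 2 - 1) ≠ 0 := by norm_num
    rcases mul_eq_zero.mp h0 with h | h
    · exact absurd h h3
    · rw [h, neg_zero]
  have h := sqSubOneSum_mul_mass_le_of_uniform _ hq hq0 hfin (J := J) hJ hj σ hσ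
  rw [totalMass_settingPrVolSharp_eq_pilotGap X hlog M archPk archSub Ψ act Mmod region n lat sig split qData tq t htq0 htq1 htq,
    ← onTrivialMass_settingPrVolSharp_eq_mass X hlog M archPk archSub Ψ act Mmod region n lat sig split qData tq t htq0 htq1 ht0 ht htq σ] at h
  have hl : ((thetaIndex X).lstar : ℕ) = X.lstar := rfl
  simpa only [hl] using h

end Bed

end Summit.ABC.IUTFork.Repair.RH.CellWeights

end
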